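import Summits.QuantumFields.YangMills.Theses.BalabanLadder
import Summits.QuantumFields.YangMills.Theses.BalabanFamilyExport

/-!
# Line `regime_split` on crux `UVSeamRec` (item stmt-QuantumFields-20043) — D-0145 ideator ym-idea-9 g2, LINE 3 (lens «complete»)

Sub-route of `route-QuantumFields-BalabanFamilyExport`: the even-class export `FamilyCeilings` (25032) is SPLIT along Bałaban's own
parameter seam into `ApexFamilyCeilings` (fixed-T_η regime: ∀ L odd > 11, ∀ ℓ_f > 0, the `MomentBounds6OnSides`-clause on the class tori
M = 2·Lⁿ of physical size M·uRec ≤ ℓ_f, constants per (L, ℓ_f) — the literal regime of Track A's apex, finite-dimensional last scale) and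
`UniformFamilyCeilings` (∃ L, ∃ ℓ_f: one set of constants on all class tori of physical size ≥ ℓ_f — the «constants independent of k, T_η,
U_k» clause of [Balaban1989LargeFieldII] Thm 1, p.356 l.1, transported to centred moments; NOT carried by the typed (B) pin,
`B16PerBareCounter.pin_not_implies_perBare`), glued by `FamilyCeilingsGlue` (provable now — proof below, `familyCeilings_of_regimeSplit`).
The five stubs are route items; `UVSeamRec_of` concludes the crux BY NAME through the route's `closes`. No summit is proved.
-/

namespace Summit.QuantumFields.YangMills.Cruxes.UVSeamRec.RegimeSplit

open Summit.QuantumFields.YangMills.Theses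
open Summit.QuantumFields.YangMills.Theses.BalabanFamilyExport

/-- stub = route item `BalabanFamilyExport.ApexFamilyCeilings` (LINE 3 child, crux). -/
theorem stub_apexFamilyCeilings : ApexFamilyCeilings := by
  sorry

/-- stub = route item `BalabanFamilyExport.UniformFamilyCeilings` (LINE 3 child, crux). -/
theorem stub_uniformFamilyCeilings : UniformFamilyCeilings := by
  sorry

/-- stub = route item `BalabanFamilyExport.FamilySeam` (stmt-QuantumFields-25033; itself split by line `volume_split`; shared). -/
theorem stub_familySeam : FamilySeam := by
  sorry

/-- stub = route item `BalabanFamilyExport.FloorsEngine` (stmt-QuantumFields-25034; v5(α) `stub_floorsEngine` verbatim; shared). -/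
theorem stub_floorsEngine : FloorsEngine := by
  sorry

/-- the glue item `FamilyCeilingsGlue`, PROVED: case split of each class torus on its physical size `M·uRec β ≤ ℓ_f`. -/
theorem familyCeilings_of_regimeSplit : ApexFamilyCeilings → UniformFamilyCeilings → FamilyCeilings := by
  intro hA hU
  obtain ⟨L, hLodd, hL, ℓf, hℓf, C₁, β₁, ℓ₁, hℓ₁, hC₁, h₁⟩ := hU
  obtain ⟨C₂, β₂, ℓ₂, hℓ₂, hC₂, h₂⟩ := hA L hLodd hL ℓf hℓf
  refine ⟨L, hLodd, hL, max C₁ C₂, max β₁ β₂, min ℓ₁ ℓ₂, lt_min hℓ₁ hℓ₂, le_max_of_le_left hC₁, ?_⟩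
  intro β hβ M _ hM n q x R hq hR hRu hRM hsep
  have hR4 : (0 : ℝ) < (R : ℝ) ^ 4 := by positivity
  by_cases hsz : (M : ℝ) * Summit.QuantumFields.YangMills.Cruxes.UVSeamRec.Transport.uRec β ≤ ℓf
  · have := h₂ β (le_trans (le_max_right _ _) hβ) M hM n q x R hq hR (le_trans hRu (min_le_right _ _)) hRM hsz hsep
    refine le_trans this (pow_le_pow_left₀ (div_nonneg hC₂ hR4.le) ?_ n)
    exact div_le_div_of_nonneg_right (le_max_right _ _) hR4.le
  · have hge : ℓf ≤ (M : ℝ) * Summit.QuantumFields.YangMills.Cruxes.UVSeamRec.Transport.uRec β :=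
      le_of_lt (lt_of_not_ge hsz)
    have := h₁ β (le_trans (le_max_left _ _) hβ) M hM n q x R hq hR (le_trans hRu (min_le_left _ _)) hRM hge hsep
    refine le_trans this (pow_le_pow_left₀ (div_nonneg hC₁ hR4.le) ?_ n)
    exact div_le_div_of_nonneg_right (le_max_left _ _) hR4.le

/-- the glue item itself, by name. -/
theorem familyCeilingsGlue_holds : FamilyCeilingsGlue := familyCeilings_of_regimeSplit

/-- informational: the uniform child is a PIECE of the parent (the parent gives it back with ℓ_f := 1). -/
theorem uniformFamilyCeilings_of_familyCeilings : FamilyCeilings → UniformFamilyCeilings := by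
  rintro ⟨L, hLodd, hL, C, β₄, ℓ₄, hℓ₄, hC, h⟩
  exact ⟨L, hLodd, hL, 1, one_pos, C, β₄, ℓ₄, hℓ₄, hC,
    fun β hβ M _ hM n q x R hq hR hRu hRM _ hsep => h β hβ M hM n q x R hq hR hRu hRM hsep⟩

/-- kernel-checked composition: the four stubs give the crux `UVSeamRec` BY NAME (route `closes` ∘ regime-split glue). -/
theorem UVSeamRec_of :
    ApexFamilyCeilings → UniformFamilyCeilings → FamilySeam → FloorsEngine →
      Summit.QuantumFields.YangMills.Theses.BalabanLadder.UVSeamRec :=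
  fun hA hU h₂ h₃ => BalabanFamilyExport.closes (familyCeilings_of_regimeSplit hA hU) h₂ h₃

/-- the crux from the stubs. -/
theorem UVSeamRec_holds_of_stubs : Summit.QuantumFields.YangMills.Theses.BalabanLadder.UVSeamRec :=
  UVSeamRec_of stub_apexFamilyCeilings stub_uniformFamilyCeilings stub_familySeam stub_floorsEngine

end Summit.QuantumFields.YangMills.Cruxes.UVSeamRec.RegimeSplit
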